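import Mathlib
import Summits.Ventures.PercRepro2.HCovOEdgeNormChord

/-!
# The normalised chord across a root edge `{a₃, a₁}`: the two X-free rows and the cubic identity
(blind cell PercRepro2, night-1 g18; NIGHT1-G18.md §2)

Along a root edge `f = {a₃, a₁}` of weight `q`, `D(q) = (1 − q) D⁰` and `HMFc = (1 − q) Φ_f`
(`RootEdge.HMFc_eq_factor`), so the normalised functional is `HMFc / (Z D) = Φ_f / (Z D⁰)`, and
its `X̂`-term `−2 X̂(q)` is affine in `q` (`XhatPin.Xhat_eq_pin`).  The chord condition of
`Φ_f / Z` on `[0, 1]`,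
`Z⁰ Z¹ · Φ_f(p) ≥ (1 − q) Z Z¹ · Φ_f(p⁰) + q Z Z⁰ · Φ_f(p¹)`,
is therefore `X̂`-free; cleared it is the cubic `q (1 − q) · ((1 − q) ρ₀ + q ρ₁)` with two
`X̂`-free rows `rootTangentZero = ρ₀`, `rootTangentOne = ρ₁` (the tangent conditions at the two
ends), built from the `X̂`-free parts `core0`, `core1` of `Φ_f(p⁰)`, `Φ_f(p¹)` and the `X̂`-free
parts `slope0`, `slope1` of the derivative of the cofactor at the two ends:

* **`root_chord_identity`**: for `f ∋ a₃`,
  `Z⁰ Z¹ · Φ_f(p) − (1 − q) Z Z¹ · Φ_f(p⁰) − q Z Z⁰ · Φ_f(p¹) = q (1 − q) ((1 − q) ρ₀ + q ρ₁)`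
  (a ring identity after pinning the masses of `Φ_f` at `p`; the `X̂`-terms cancel).

The consequences — (HMF) and (HCOV) across the root edge from the two rows — are in
`HMFRootEdgeNormChord`.  Own code; standard axioms.
-/

namespace Summit.Ventures.PercRepro2

open UnionCluster CovForm

namespace RootEdge

section NormChord

variable {V : Type*} {E : Type*} [Fintype E] [DecidableEq E] [Fintype V] [DecidableEq V]
  {R : Type*} [Field R] [LinearOrder R] [IsStrictOrderedRing R]

variable (p : E → R) (ends : E → Sym2 V) (o a₁ a₂ a₃ b : V) (f : E)

/-- The `X̂`-free part of `Φ_f(p⁰)` (`= HMFc(p⁰) + 2 Z⁰ D⁰ X̂⁰`):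
`2 Z⁰ D_o⁰ W⁰ − gap⁰ (D_o⁰ (Z⁰ − S₃⁰) − D⁰ J⁰)`, `J = EQo − EQ3o`. -/
noncomputable def core0 : R :=
  2 * prob (Function.update p f 0) (avoidAll ends a₂ {a₁}) *
      Do (Function.update p f 0) ends o a₁ a₂ a₃ *
      (massM2 (Function.update p f 0) ends a₁ a₂ a₃ b +
        deltaT (Function.update p f 0) ends a₁ a₂ a₃ b) -
    gap (Function.update p f 0) ends a₁ a₂ b *
      (Do (Function.update p f 0) ends o a₁ a₂ a₃ *
          (prob (Function.update p f 0) (avoidAll ends a₂ {a₁}) -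
            EQ3 (Function.update p f 0) ends a₁ a₂ a₃) -
        prob (Function.update p f 0) (PDEvent ends a₁ a₂ a₃) *
          (EQo (Function.update p f 0) ends o a₁ a₂ -
            EQ3o (Function.update p f 0) ends o a₁ a₂ a₃))

/-- The `X̂`-free part of `Φ_f(p¹)`: `−gap¹ (D_o⁰ (Z¹ − S₃¹) − D⁰ J¹)`. -/
noncomputable def core1 : R :=
  -(gap (Function.update p f 1) ends a₁ a₂ b *
      (Do (Function.update p f 0) ends o a₁ a₂ a₃ *
          (prob (Function.update p f 1) (avoidAll ends a₂ {a₁}) -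
            EQ3 (Function.update p f 1) ends a₁ a₂ a₃) -
        prob (Function.update p f 0) (PDEvent ends a₁ a₂ a₃) *
          (EQo (Function.update p f 1) ends o a₁ a₂ -
            EQ3o (Function.update p f 1) ends o a₁ a₂ a₃)))

/-- The `X̂`-free part of `Φ_f′(0)` (the derivative of the cofactor in `q` at `q = 0`; `δm = m¹ − m⁰`):
`2 δZ D_o⁰ W⁰ − 2 Z⁰ D_o⁰ W⁰ − δgap (D_o⁰ (Z⁰ − S₃⁰) − D⁰ J⁰) − gap⁰ (D_o⁰ (δZ − δS₃) − D⁰ δJ)`. -/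
noncomputable def slope0 : R :=
  2 * (prob (Function.update p f 1) (avoidAll ends a₂ {a₁}) -
        prob (Function.update p f 0) (avoidAll ends a₂ {a₁})) *
      Do (Function.update p f 0) ends o a₁ a₂ a₃ *
      (massM2 (Function.update p f 0) ends a₁ a₂ a₃ b +
        deltaT (Function.update p f 0) ends a₁ a₂ a₃ b) -
    2 * prob (Function.update p f 0) (avoidAll ends a₂ {a₁}) *
      Do (Function.update p f 0) ends o a₁ a₂ a₃ *
      (massM2 (Function.update p f 0) ends a₁ a₂ a₃ b +
        deltaT (Function.update p f 0) ends a₁ a₂ a₃ b) -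
    (gap (Function.update p f 1) ends a₁ a₂ b - gap (Function.update p f 0) ends a₁ a₂ b) *
      (Do (Function.update p f 0) ends o a₁ a₂ a₃ *
          (prob (Function.update p f 0) (avoidAll ends a₂ {a₁}) -
            EQ3 (Function.update p f 0) ends a₁ a₂ a₃) -
        prob (Function.update p f 0) (PDEvent ends a₁ a₂ a₃) *
          (EQo (Function.update p f 0) ends o a₁ a₂ -
            EQ3o (Function.update p f 0) ends o a₁ a₂ a₃)) -
    gap (Function.update p f 0) ends a₁ a₂ b *
      (Do (Function.update p f 0) ends o a₁ a₂ a₃ *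
          ((prob (Function.update p f 1) (avoidAll ends a₂ {a₁}) -
              prob (Function.update p f 0) (avoidAll ends a₂ {a₁})) -
            (EQ3 (Function.update p f 1) ends a₁ a₂ a₃ -
              EQ3 (Function.update p f 0) ends a₁ a₂ a₃)) -
        prob (Function.update p f 0) (PDEvent ends a₁ a₂ a₃) *
          ((EQo (Function.update p f 1) ends o a₁ a₂ -
              EQ3o (Function.update p f 1) ends o a₁ a₂ a₃) -
            (EQo (Function.update p f 0) ends o a₁ a₂ -
              EQ3o (Function.update p f 0) ends o a₁ a₂ a₃)))

/-- The `X̂`-free part of `Φ_f′(1)`: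
`−2 Z¹ D_o⁰ W⁰ − δgap (D_o⁰ (Z¹ − S₃¹) − D⁰ J¹) − gap¹ (D_o⁰ (δZ − δS₃) − D⁰ δJ)`. -/
noncomputable def slope1 : R :=
  -(2 * prob (Function.update p f 1) (avoidAll ends a₂ {a₁}) *
      Do (Function.update p f 0) ends o a₁ a₂ a₃ *
      (massM2 (Function.update p f 0) ends a₁ a₂ a₃ b +
        deltaT (Function.update p f 0) ends a₁ a₂ a₃ b)) -
    (gap (Function.update p f 1) ends a₁ a₂ b - gap (Function.update p f 0) ends a₁ a₂ b) *
      (Do (Function.update p f 0) ends o a₁ a₂ a₃ *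
          (prob (Function.update p f 1) (avoidAll ends a₂ {a₁}) -
            EQ3 (Function.update p f 1) ends a₁ a₂ a₃) -
        prob (Function.update p f 0) (PDEvent ends a₁ a₂ a₃) *
          (EQo (Function.update p f 1) ends o a₁ a₂ -
            EQ3o (Function.update p f 1) ends o a₁ a₂ a₃)) -
    gap (Function.update p f 1) ends a₁ a₂ b *
      (Do (Function.update p f 0) ends o a₁ a₂ a₃ *
          ((prob (Function.update p f 1) (avoidAll ends a₂ {a₁}) -
              prob (Function.update p f 0) (avoidAll ends a₂ {a₁})) -
            (EQ3 (Function.update p f 1) ends a₁ a₂ a₃ -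
              EQ3 (Function.update p f 0) ends a₁ a₂ a₃)) -
        prob (Function.update p f 0) (PDEvent ends a₁ a₂ a₃) *
          ((EQo (Function.update p f 1) ends o a₁ a₂ -
              EQ3o (Function.update p f 1) ends o a₁ a₂ a₃) -
            (EQo (Function.update p f 0) ends o a₁ a₂ -
              EQ3o (Function.update p f 0) ends o a₁ a₂ a₃)))

/-- **The tangent row at `q = 0`** of the chord of `Φ_f / Z`:
`ρ₀ = Z⁰ Z¹ · slope0 + (2 Z⁰ − Z¹) Z¹ · core0 − (Z⁰)² · core1`. -/
noncomputable def rootTangentZero : R :=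
  prob (Function.update p f 0) (avoidAll ends a₂ {a₁}) *
      prob (Function.update p f 1) (avoidAll ends a₂ {a₁}) * slope0 p ends o a₁ a₂ a₃ b f +
    (2 * prob (Function.update p f 0) (avoidAll ends a₂ {a₁}) -
        prob (Function.update p f 1) (avoidAll ends a₂ {a₁})) *
      prob (Function.update p f 1) (avoidAll ends a₂ {a₁}) * core0 p ends o a₁ a₂ a₃ b f -
    prob (Function.update p f 0) (avoidAll ends a₂ {a₁}) *
      prob (Function.update p f 0) (avoidAll ends a₂ {a₁}) * core1 p ends o a₁ a₂ a₃ b f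

/-- **The tangent row at `q = 1`** of the chord of `Φ_f / Z`:
`ρ₁ = −Z⁰ Z¹ · slope1 − (Z¹)² · core0 + (2 Z¹ − Z⁰) Z⁰ · core1`. -/
noncomputable def rootTangentOne : R :=
  -(prob (Function.update p f 0) (avoidAll ends a₂ {a₁}) *
      prob (Function.update p f 1) (avoidAll ends a₂ {a₁}) * slope1 p ends o a₁ a₂ a₃ b f) -
    prob (Function.update p f 1) (avoidAll ends a₂ {a₁}) *
      prob (Function.update p f 1) (avoidAll ends a₂ {a₁}) * core0 p ends o a₁ a₂ a₃ b f +
    (2 * prob (Function.update p f 1) (avoidAll ends a₂ {a₁}) -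
        prob (Function.update p f 0) (avoidAll ends a₂ {a₁})) *
      prob (Function.update p f 0) (avoidAll ends a₂ {a₁}) * core1 p ends o a₁ a₂ a₃ b f

variable {a₁ a₂ a₃ f}

omit [LinearOrder R] [IsStrictOrderedRing R] in
/-- **The root-edge chord identity**: for `f ∋ a₃`,
`Z⁰ Z¹ · Φ_f(p) − (1 − q) Z Z¹ · Φ_f(p⁰) − q Z Z⁰ · Φ_f(p¹) = q (1 − q) ((1 − q) ρ₀ + q ρ₁)`
(the `X̂`-terms cancel: the mean field is affine along the edge). -/
theorem root_chord_identity (hf : a₃ ∈ ends f) :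
    prob (Function.update p f 0) (avoidAll ends a₂ {a₁}) *
          prob (Function.update p f 1) (avoidAll ends a₂ {a₁}) * Phi p ends o a₁ a₂ a₃ b f -
        (1 - p f) * prob p (avoidAll ends a₂ {a₁}) *
          prob (Function.update p f 1) (avoidAll ends a₂ {a₁}) *
          Phi (Function.update p f 0) ends o a₁ a₂ a₃ b f -
        p f * prob p (avoidAll ends a₂ {a₁}) *
          prob (Function.update p f 0) (avoidAll ends a₂ {a₁}) *
          Phi (Function.update p f 1) ends o a₁ a₂ a₃ b f =
      p f * (1 - p f) * ((1 - p f) * rootTangentZero p ends o a₁ a₂ a₃ b f +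
        p f * rootTangentOne p ends o a₁ a₂ a₃ b f) := by
  have hX := XhatPin.Xhat_eq_pin p ends o a₁ a₂ a₃ b hf
  unfold rootTangentZero rootTangentOne slope0 slope1 core0 core1 Phi CovForm.Do CovForm.EQo
    CovForm.EQ3 CovForm.EQ3o CovForm.gap massM2 deltaT
  simp only [Function.update_idem, Function.update_self]
  rw [hX, prob_eq_pin p (avoidAll ends a₂ {a₁}) f, prob_eq_pin p (connEvent ends a₂ b) f,
    prob_eq_pin p (connEvent ends a₁ b) f, prob_eq_pin p (TEvent ends a₂ a₁ a₃) f,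
    prob_eq_pin p (TEvent ends a₁ a₂ a₃) f,
    prob_eq_pin p (avoidAll ends a₂ {a₁} ∩ connEvent ends a₁ o) f,
    prob_eq_pin p (avoidAll ends a₂ {a₁} ∩ connEvent ends a₂ o) f,
    prob_eq_pin p (TEvent ends a₂ a₁ a₃ ∩ connEvent ends a₁ o) f,
    prob_eq_pin p (TEvent ends a₂ a₁ a₃ ∩ connEvent ends a₂ o) f,
    prob_eq_pin p (TEvent ends a₁ a₂ a₃ ∩ connEvent ends a₁ o) f,
    prob_eq_pin p (TEvent ends a₁ a₂ a₃ ∩ connEvent ends a₂ o) f]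
  ring

end NormChord

end RootEdge

end Summit.Ventures.PercRepro2
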